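import Summits.BirchSwinnertonDyer.BirchSwinnertonDyer.Theses.PrintX10b
import Summits.BirchSwinnertonDyer.BirchSwinnertonDyer.Theorems.PrintX10bHowardContainmentLightFrameX10bOfMuStabilized
import Summits.BirchSwinnertonDyer.BirchSwinnertonDyer.Theorems.PrintX9MuPartStabilizedDefs
import Summits.BirchSwinnertonDyer.Rank1Residual.X9.LeafDischargeScalarImage
import Summits.BirchSwinnertonDyer.Rank1Residual.X10.LeafDischargeX10b
import HarnessLib

/-!
# Closers for the split children of `PrintX10b.HowardContainmentLightFrameX10bPinnedOfPrint` (stmt-27275, row 10):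
# `CoprimeTiedX10b` (stmt-27485), `EnvelopeModulesSharpX10b` (stmt-27486), and the X10b SPECIALISATION of the cell's ONE
# shared μ-letter `HeegnerMuPartStabilized.MuPartStabilizedOfPrint` (plan g10 THE CUT 10:51:14Z) to the row-10 letter
# `PrintX10bSharpMuStabilized.Stmt.muInequalityStabilized`, with the light A₃ containment from print ⊕ the shared letter

Cell `pub/bsd-print-x9`, LEAD `bsd-line-x10b-p2` (g3). THEOREMS ONLY (no definition, no named fact, no `sorry`). Closes
BY NAME the two support children of PrintX10b rev 36 (`coprimeTiedX10b_holds`, `envelopeModulesSharpX10b_holds` — the rev-27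
skeleton's proofs over p607508 / p621830, the planner's turnkey `PrintX10bSplitClosers.lean` deduplicated and made
PrintX9-free); gives `muInequalityStabilizedX10b_of_common : MuPartStabilizedOfPrint → Stmt.muInequalityStabilized` (the
X10b frame discharges the shared letter's extra binders: `Thm413Hypotheses` by `X10.thm413Hypotheses_of_classX10`,
irr_ℚ by `ClassX10.irr`, the MZ26 scalar clause by `ClassX10.hasPadicScalarImage_of_not_surj`) and the two compositions
the new resplit glue wants: `howardContainmentLightFrameX10bPinnedOfPrint_of_common : MuPartStabilizedOfPrint →
HowardContainmentLightFrameX10bPinnedOfPrint` and the three-binder form `…_of_children_of_common : CoprimeTiedX10b →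
EnvelopeModulesSharpX10b → MuPartStabilizedOfPrint → HowardContainmentLightFrameX10bPinnedOfPrint` (the children are not
needed by the proof — the closer re-derives both regimes — and are kept to match the glue's shape). The shared μ-letter is
BEYOND citable PRINT at `3 ∣ h_K` (REF-118); nothing about it is claimed here. «beyond-print theorem»: no. No summit
statement is proved by this seat; BSD is not proved by any of this.

References: Mastella–Zerman, arXiv:2505.08710, Cor. 4.6, Ass. 2.13 (v); Lombardo–Tronto 2022 Prop. 3.12; Castella–Grossi–
Lee–Skinner, Invent. Math. 227 (2022), Thm. 4.1.1, Rem. 4.1.4; Castella–Grossi–Skinner, Math. Ann. 393 (2025), Thm. 6.5.2;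
Howard, Compositio 140 (2004), §3.3, Thm. 3.3.7; Perrin-Riou, Bull. SMF 115 (1987), §3.4.
-/

set_option linter.dupNamespace false
set_option autoImplicit false

noncomputable section

open scoped Classical Pointwise
open Literature Literature.NumberTheory.EllipticCurves WeierstrassCurve
  Literature.NumberTheory.EllipticCurves.ModularForms
  Literature.NumberTheory.EllipticCurves.CastellaGrossiLeeSkinner2022
open Literature.NumberTheory.EllipticCurves.Rank1Residual (ClassX10 Surj)
open Summit.BirchSwinnertonDyer.BirchSwinnertonDyer.Theses.PrintX10b
open Summit.BirchSwinnertonDyer.BirchSwinnertonDyer.Theorems.HeegnerMuPartStabilized (MuPartStabilizedOfPrint)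

namespace Summit.BirchSwinnertonDyer.BirchSwinnertonDyer.Theorems.PrintX10bSplitStabilized

open Summit.BirchSwinnertonDyer.BirchSwinnertonDyer.Theorems (PrintX10bSharpMuStabilized.Stmt.muInequalityStabilized
  PrintX10bSharpMuStabilized.howardContainmentLightFrameX10bPinnedOfPrint_of_muStabilized)

/-! ## §1 The two support children close at once -/

/-- **`CoprimeTiedX10b` holds** (stmt-BirchSwinnertonDyer-27485, split child 1/3 of 27275): the `3 ∤ h_K` regime of the
pinned light containment from the Mastella–Zerman binder alone — the rev-27 skeleton's `stub_coprimeTied` proof via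
`X10.heegnerContainmentPinned_of_cor46_of_not_surj` (p607508); `d_K ≠ -4` from `d_K` odd.
[cite: MastellaZerman2026, Cor. 4.6 (arXiv:2505.08710)] [cite: LombardoTronto2022, Prop. 3.12] -/
theorem coprimeTiedX10b_holds : CoprimeTiedX10b := by
  intro hMZ W _ _ p _ _ K _ _ hX hns hcm hK hodd h3 hHN hHp _ κ hκ γ hγ Dt H _ jbar _ _ _ hhK
  have h46 : MastellaZerman2026.cor46_howardDivisibility_of_scalarImage.{0} := hMZ
  obtain ⟨D, F, X, hFD, -, hle⟩ :=
    Summit.BirchSwinnertonDyer.BirchSwinnertonDyer.Rank1Residual.X10.heegnerContainmentPinned_of_cor46_of_not_surj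
      h46 hX hns hcm hK h3 (hK.discr_lt_neg_four_of_odd hodd h3).ne hHN hHp hhK κ hκ γ hγ Dt H jbar
  exact ⟨D, F, X, hFD, hle⟩

/-- **`EnvelopeModulesSharpX10b` holds** (stmt-BirchSwinnertonDyer-27486, split child 2/3 of 27275): the MODULE-LEVEL
Heegner envelope at every class number from the Tower♯ binder — `X10.envelopeModules_of_towerSharp` (p621830; the
child's `Submodule.map (DistribSMul.toLinearMap …)` is the scoped-pointwise `•` by definition).
[cite: Howard2004HeegnerKolyvagin, §3.3, Thm. 3.3.7] [cite: PerrinRiou1987BSMF, §3.4 Prop. 10]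
[cite: CastellaGrossiLeeSkinner2022, Rem. 4.1.4] -/
theorem envelopeModulesSharpX10b_holds : EnvelopeModulesSharpX10b := by
  intro hTw W _ _ p _ _ K _ _ hX hns hcm hK hodd h3 hHN hHp _ κ hκ γ hγ Dt H jbar D _
  have hp : p.Prime := Fact.out
  exact Summit.BirchSwinnertonDyer.BirchSwinnertonDyer.Rank1Residual.X10.envelopeModules_of_towerSharp hX hK hodd h3
    hHN hHp hκ hγ Dt H jbar (fun k ↦ hTw K p (hp.odd_of_ne_two hX.ne_two) hK κ hκ jbar k) D

/-! ## §2 The shared μ-letter specialises to the row-10 letter -/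

/-- **Shared μ-letter ⟹ row-10 letter**: `HeegnerMuPartStabilized.MuPartStabilizedOfPrint` (plan g10's ONE μ-item text for
rows 9 and 10: `Thm413Hypotheses`, `¬ CM`, irr_ℚ, irr_K, MZ26 scalar clause, `p` split, `p ∣ h_K`) implies
`Stmt.muInequalityStabilized` (the X10b light-frame letter): at an X10b pair on an odd-`d_K` Heegner frame the extra
binders are theorems — `X10.thm413Hypotheses_of_classX10` (p606553), `ClassX10.irr`, `ClassX10.hasPadicScalarImage_of_not_surj`
(Lombardo–Tronto); the rank / `Ш` binders of the row letter are idle. [cite: LombardoTronto2022, Prop. 3.12]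
[cite: MastellaZerman2026, Assumption 2.13 (v)] [cite: CastellaGrossiLeeSkinner2022, Thm. 4.1.3 hypotheses] -/
theorem muInequalityStabilizedX10b_of_common (h : MuPartStabilizedOfPrint) :
    PrintX10bSharpMuStabilized.Stmt.muInequalityStabilized := by
  intro W _ _ p _ _ K _ _ hX hns hcm hK hodd h3 hHN hHp hirr κ hκ γ hγ _ _ hhK jbar D C X hfS hfX htor 𝔭 h𝔭
  have hirrQ : W.HasIrreducibleModPGaloisRep p := by
    obtain ⟨rfl, -⟩ := id hX
    exact hX.irr
  exact h (W.conductorNorm ℤ) W K p κ γ jbar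
    (Summit.BirchSwinnertonDyer.BirchSwinnertonDyer.Rank1Residual.X10.thm413Hypotheses_of_classX10 hX hK h3 hHN hHp hodd
      hκ hγ)
    hcm hirrQ hirr (Rank1Residual.ClassX10.hasPadicScalarImage_of_not_surj hX hns) hHp hhK D C X hfS hfX htor 𝔭 h𝔭

/-! ## §3 The parent from the shared μ-letter (the resplit glue's content) -/

/-- **`HowardContainmentLightFrameX10bPinnedOfPrint` ⟸ the shared μ-letter** (closer p625072 ∘ specialisation): the row-10
deciding parent from plan g10's ONE μ-item text. [cite: CastellaGrossiSkinner2025, Thm. 6.5.2]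
[cite: CastellaGrossiLeeSkinner2022, Thm. 4.1.1] [cite: MastellaZerman2026, Cor. 4.6] -/
theorem howardContainmentLightFrameX10bPinnedOfPrint_of_common (h : MuPartStabilizedOfPrint) :
    HowardContainmentLightFrameX10bPinnedOfPrint :=
  PrintX10bSharpMuStabilized.howardContainmentLightFrameX10bPinnedOfPrint_of_muStabilized
    (muInequalityStabilizedX10b_of_common h)

/-- **The resplit glue's shape: children ⟹ parent** — `CoprimeTiedX10b → EnvelopeModulesSharpX10b → (shared μ-letter) →
HowardContainmentLightFrameX10bPinnedOfPrint`. The two support children are not used by the proof (the closer re-derives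
the `3 ∤ h_K` regime from `hMZ` and the sharp envelope from `hTw`); they are binders of the glue only. Instantiate at the
route's shared decl by `Iff.rfl` on the letter. [cite: CastellaGrossiSkinner2025, Thm. 6.5.2] [cite: MastellaZerman2026, Cor. 4.6] -/
theorem howardContainmentLightFrameX10bPinnedOfPrint_of_children_of_common (_hcop : CoprimeTiedX10b)
    (_henv : EnvelopeModulesSharpX10b) (h : MuPartStabilizedOfPrint) : HowardContainmentLightFrameX10bPinnedOfPrint :=
  howardContainmentLightFrameX10bPinnedOfPrint_of_common h

/-- **The LIGHT A₃ containment from the four print binders and the shared μ-letter** (curried form for consumers of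
`HowardContainmentLightFrameX10bPinned`, e.g. the closed assembly `AssemblyLightTwinsX10b`).
[cite: CastellaGrossiSkinner2025, Thm. 6.5.2] [cite: MastellaZerman2026, Cor. 4.6] -/
theorem howardContainmentLightFrameX10bPinned_of_print_of_common (h : MuPartStabilizedOfPrint)
    (hMZ : MastellaZermanHowardDivisibility) (hNV : CGLSHeegnerClassNonvanishing)
    (hCGS : CGSHowardDivisibilityPLocalized) (hTw : AnticyclotomicTowerSharp) :
    HowardContainmentLightFrameX10bPinned :=
  howardContainmentLightFrameX10bPinnedOfPrint_of_common h hMZ hNV hCGS hTw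

end Summit.BirchSwinnertonDyer.BirchSwinnertonDyer.Theorems.PrintX10bSplitStabilized

end
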